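import Literature.AlgebraicGeometry.GroupSchemes.ClosedSubgroupDichotomyOfPointCount
import Literature.AlgebraicGeometry.Motives.AbelianVarietyEtaleIsogenyFrobeniusKernel
import HarnessLib

/-!
# Étale by point count: a finite group scheme over an algebraically closed field with as many points as its rank is étale

Topic `Literature/AlgebraicGeometry/GroupSchemes`; namespace `Literature.AlgebraicGeometry.GroupSchemes`.  THEOREMS ONLY (no definition, no
named fact, no instance, no notation, no `sorry`).  Cell `hodgecm-mathlib` (D-0151), FLOOR 0, P6 «MOD programme» (crux hLiu418 =
stmt-HodgeConjecture-24832, `--supports`, count-neutral): organ **(O-δ) «MULT-BLOCK ∕ FROB₀-UNIT», part 5 «ÉTALE KERNEL BY POINT COUNT»** (lead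
hand B-p17).  The heart's field `frob₀_et` is a POINT COUNT («`#A₀[𝔭_{c•w}](κ̄) = q`», desk F0P6a-plan (g1) D-3), whereas the étale-kernel tower of
★ `FrobeniusKernelInclusionAssembly` wants `Ker ι(a) → Spec κ̄` ÉTALE.  This file wraps ★ (E-b-ét)
`ClosedSubgroupDichotomyOfPointCount.etale_of_natCard_hom_eq_finrank` (over an algebraically closed field a finite group scheme with `#G(k) = rank G`
is étale — the unit component is forced to have rank one, ★ (O-b1k)), reading the rank (b) in Mathlib's `Scheme.Hom.finrank` currency instead of the
`Γ(G, 𝒪_G)`-currency, and (c) for KERNELS `Ker φ` of finite flat homomorphisms, whose rank is the rank of `φ` (★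
`finrank_ker_hom_eq_finrank_left`) and whose points are the points of `G` killed by `φ` (★ `kerPoints`).  HC_CM is proved only modulo the
printed citations until rung 0 closes; this file is generic and changes no count.

THE MATHEMATICS ([Tate1997FiniteFlatGroupSchemes] (3.7); [MumfordAV1970] §11 Thm. p. 101 and §14): for `G` finite over `k = k̄` with unit
component `G⁰`, `rank G = #G(k) · rank G⁰` (★ (b1cg)); so `#G(k) = rank G` forces `rank G⁰ = 1`, `G⁰ = Spec k`, i.e. `G = G^{ét}` is étale.
For a finite flat homomorphism `φ : G → H` the kernel `Ker φ = G ×_{H,e} Spec k` is finite flat of rank `rank φ` ([StacksProject] Tag 02KA, base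
change of the rank function) and `(Ker φ)(k) = {t ∈ G(k) | φ(t) = e}`.

* `etale_of_natCard_eq_hom_finrank` (finite `k`-group schemes, `Scheme.Hom.finrank` form of ★ `etale_of_natCard_hom_eq_finrank`),
  `natCard_hom_ker_eq_natCard_subtype`, **`etale_ker_of_natCard_eq_finrank`**, **`etale_ker_of_natCard_subtype_eq_finrank`** (kernels).

## References
* [Tate1997FiniteFlatGroupSchemes] J. Tate, *Finite flat group schemes*, in Cornell–Silverman–Stevens (1997), (3.7) (connected–étale sequence,
  `|G| = |G⁰|·|G^{ét}|`).
* [MumfordAV1970] D. Mumford, *Abelian Varieties* (1970), §11 (p. 101: finite group schemes over `k = k̄`), §14 (étale group schemes).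
* [StacksProject] The Stacks project, Tag 02KA (rank of a finite locally free morphism, base change), Tag 00U3.
-/

set_option autoImplicit false

noncomputable section

universe u

open CategoryTheory CategoryTheory.Limits AlgebraicGeometry MonoidalCategory CartesianMonoidalCategory
open scoped MonObj

namespace Literature.AlgebraicGeometry.GroupSchemes

open Literature.AlgebraicGeometry.Motives (SchemeOver specOver)
open GroupSchemeKernel

section PointCount

variable (k : Type u) [Field k] [IsAlgClosed k]

/-- **`#G(k) = rank (G → Spec k)` ⟹ `G` étale**, the rank in Mathlib's `Scheme.Hom.finrank` currency (★ `hom_finrank_eq_finrank_alg`).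
[cite: Tate1997FiniteFlatGroupSchemes, (3.7)] [cite: StacksProject, Tag 02KA] -/
theorem etale_of_natCard_eq_hom_finrank (G : Over (Spec (.of k))) [GrpObj G] [IsFinite G.hom] (s : ↥(Spec (.of k)))
    (h : Nat.card (𝟙_ (Over (Spec (.of k))) ⟶ G) = G.hom.finrank s) : Etale G.hom := by
  refine etale_of_natCard_hom_eq_finrank G ?_
  rw [h, hom_finrank_eq_finrank_alg G s]

/-- **ÉTALE KERNEL BY POINT COUNT.**  `φ : G → H` a finite flat homomorphism of `k`-group schemes (`k` algebraically closed).  If `Ker φ` has as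
many `k`-points as the rank of `φ` (at the unit point), then `Ker φ → Spec k` is ÉTALE (`rank Ker φ = rank φ`, ★ `finrank_ker_hom_eq_finrank_left`).
For the CM factor of the heart: `#A₀[a](κ̄) = deg ι₀(a)` ⟹ `Ker ι₀(a)` étale — the hypothesis `het` of ★ `FrobeniusKernelInclusionAssembly`.
[cite: Tate1997FiniteFlatGroupSchemes, (3.7)] [cite: StacksProject, Tag 02KA] [cite: MumfordAV1970, §14] -/
theorem etale_ker_of_natCard_eq_finrank {G H : Over (Spec (.of k))} [GrpObj G] [GrpObj H] (φ : G ⟶ H) [IsMonHom φ]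
    [IsFinite φ.left] [Flat φ.left] (s : ↥(Spec (.of k)))
    (h : Nat.card (𝟙_ (Over (Spec (.of k))) ⟶ ker φ) = φ.left.finrank ((η[H] : 𝟙_ (Over (Spec (.of k))) ⟶ H).left s)) :
    Etale (ker φ).hom := by
  haveI := isFinite_ker_hom_of_isFinite_left φ
  refine etale_of_natCard_eq_hom_finrank k (ker φ) s ?_
  rw [h, finrank_ker_hom_eq_finrank_left φ s]

omit [IsAlgClosed k] in
/-- The `k`-points of `Ker φ` are the `k`-points of `G` killed by `φ` (★ `kerPoints`). [cite: StacksProject, Tag 02KA]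
[cite: MumfordAV1970, §11 (p. 101)] -/
theorem natCard_hom_ker_eq_natCard_subtype {G H : Over (Spec (.of k))} [GrpObj G] [GrpObj H] (φ : G ⟶ H) [IsMonHom φ] :
    Nat.card (𝟙_ (Over (Spec (.of k))) ⟶ ker φ) = Nat.card {t : 𝟙_ (Over (Spec (.of k))) ⟶ G // t ≫ φ = 1} := by
  refine Nat.card_congr ((kerPoints φ (𝟙_ (Over (Spec (.of k))))).toEquiv.trans ?_)
  exact Equiv.subtypeEquivRight fun t => mem_ker_iff φ t

/-- **ÉTALE KERNEL BY POINT COUNT, points of `G` form**: if `#{t ∈ G(k) | t ≫ φ = 1} = rank φ`, then `Ker φ` is étale — the shape of the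
heart's `frob₀_et` («`#A₀[𝔭_{c•w}](κ̄) = q`»). [cite: Tate1997FiniteFlatGroupSchemes, (3.7)] [cite: StacksProject, Tag 02KA] [cite: MumfordAV1970, §14] -/
theorem etale_ker_of_natCard_subtype_eq_finrank {G H : Over (Spec (.of k))} [GrpObj G] [GrpObj H] (φ : G ⟶ H) [IsMonHom φ]
    [IsFinite φ.left] [Flat φ.left] (s : ↥(Spec (.of k)))
    (h : Nat.card {t : 𝟙_ (Over (Spec (.of k))) ⟶ G // t ≫ φ = 1} = φ.left.finrank ((η[H] : 𝟙_ (Over (Spec (.of k))) ⟶ H).left s)) :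
    Etale (ker φ).hom :=
  etale_ker_of_natCard_eq_finrank k φ s ((natCard_hom_ker_eq_natCard_subtype k φ).trans h)

end PointCount

end Literature.AlgebraicGeometry.GroupSchemes

end
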